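import Literature.NumberTheory.LFunctions.GaussianRayHeckeZFR
import Mathlib.Analysis.ODE.Gronwall
import HarnessLib

/-!
# `|F(1)| ≫ (log Q)⁻³` for a twisted `L`-function without exceptional zero, and `L(1, ψ)` for the
# Hecke `L`-functions of `ℚ(i)`

Topic `Literature/NumberTheory/LFunctions`. Everything is PROVED (theorems only; no definition, no
named fact). A small consequence of the abstract twisted zero-free-region machinery
`TwistedZFRData` (`TwistedZeroFreeRegion.lean`: Montgomery–Vaughan §11.1 axiomatised): in the
case `pole = false` (no exceptional real zero) the crude logarithmic-derivative bound of
`TwistedZFRData.exists_logDeriv_bound_const` (MV Theorem 11.4, (11.5): `F'/F ≪ ℒ₀³` on `σ ≥ 1`,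
`ℒ₀ = log Q + log 4`) integrates, by Grönwall's inequality on the real segment `[1, 1 + δ]`
(`δ = 1/B`, `B` the bound), to `|F(1 + δ)| ≤ e |F(1)|`, and the field `lower`
(`|F(1+δ)| ≥ c₁ δ`) gives

* `TwistedZFRData.exists_const_norm_one_ge` — for fixed numeric parameters there is `c₀ > 0` with
  **`|F(1)| ≥ c₀ / (log Q + log 4)³`** for EVERY datum with `pole = false` (MV Theorem 11.4, (11.7)
  at `s = 1`: "`1/L(s, χ) ≪ log qτ`", here in the crude cubic form that the tree's (11.5) gives);
* `GaussianCosetTheta.exists_norm_heckeL_one_ge` — **`|L(1, ψ)| ≥ c₀/(log(M(k+2)) + log 4)³`** with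
  an ABSOLUTE `c₀ > 0`, for all `M` with `4 ∣ M`, all characters `χ` of `(ℤ[i]/M)ˣ` and all `k ≥ 1`,
  `ψ = χ · (z/|z|)^k`, `L(s, ψ) = heckeL M χ k` (Friedlander–Iwaniec, Ann. of Math. 148 (1998), §16,
  (16.19)–(16.20): the classical bounds for `L(s, ψ)` "by classical arguments"; the datum is the
  tree's `twistedZFRData_heckeL`).

The second statement is the analytic input of the lower bound for `L(1, Sym² f)` on the newforms of
the elliptic curves with `j = 1728` (Hoffstein–Lockhart's theorem on that CM family is a statement
about Hecke `L`-functions of `ℚ(i)`).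

## References

* H. L. Montgomery, R. C. Vaughan, *Multiplicative Number Theory I*, CUP 2007, §11.1, Theorem 11.4,
  (11.5) and (11.7). [cite: MontgomeryVaughan2007, §11.1 Theorem 11.4]
* J. Friedlander, H. Iwaniec, Ann. of Math. (2) 148 (1998), 945–1040, §16 (16.19)–(16.20).
  [cite: FriedlanderIwaniecAnnals1998, §16 (16.20)]

## Mathlib / tree search

Tree: `TwistedZFRData.exists_logDeriv_bound_const`, fields `lower`, `differentiableOn`
(`TwistedZeroFreeRegion`); `twistedZFRData_heckeL`, `nS_pos`, `K0_nonneg`, `C2_nonneg`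
(`GaussianRayHeckeZFR`). Mathlib: `norm_le_gronwallBound_of_norm_deriv_right_le`, `gronwallBound_ε0`,
`HasDerivAt.comp_ofReal`. `lean search 'norm.*heckeL.*one|LOne.*Twisted'`: nothing of this kind
(`HeckeLOneBound.lean` records MV (11.7) for Dirichlet characters as named facts).
-/

noncomputable section

open Complex Filter Topology Set Metric

namespace Literature.NumberTheory.LFunctions

namespace TwistedZFRData

/-- **`|F(1)| ≫ (log Q + log 4)⁻³` in the absence of an exceptional zero** (MV Theorem 11.4, (11.7) at
`s = 1`, crude cubic form): for fixed numeric parameters `η, A, C_g, c₁, K₀, C₂` there is `c₀ > 0`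
such that every datum `TwistedZFRData η A C_g c₁ K₀ C₂ false Q Λ₀ Λ₁ Λ₂ F` has
`c₀ / (log Q + log 4)³ ≤ ‖F 1‖`. Proof: `‖F'/F‖ ≤ B = C ℒ₀³ log 4` on `[1, 2]`
(`exists_logDeriv_bound_const`, no exceptional zeros when `pole = false`), Grönwall on
`[1, 1 + δ]`, `δ = 1/max(B,1)`: `c₁ δ ≤ ‖F(1+δ)‖ ≤ ‖F 1‖ e^{Bδ} ≤ e ‖F 1‖`.
[cite: MontgomeryVaughan2007, §11.1 Theorem 11.4 (11.7)] -/
theorem exists_const_norm_one_ge {η A Cg c₁ K₀ C₂ : ℝ} (hη : 0 < η) (hη1 : η ≤ 1) (hA : 0 ≤ A)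
    (hc₁ : 0 < c₁) (hK₀ : 0 ≤ K₀) (hC₂ : 0 ≤ C₂) :
    ∃ c₀ : ℝ, 0 < c₀ ∧ ∀ (Q : ℝ) (Λ₀ : ℕ → ℝ) (Λ₁ Λ₂ : ℕ → ℂ) (F : ℂ → ℂ),
      TwistedZFRData η A Cg c₁ K₀ C₂ false Q Λ₀ Λ₁ Λ₂ F →
        c₀ / (Real.log Q + Real.log 4) ^ 3 ≤ ‖F 1‖ := by
  obtain ⟨c, hc, C, hC, hzf, hbd⟩ := exists_logDeriv_bound_const (Cg := Cg) (c₁ := c₁) hη hη1 hA hK₀ hC₂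
  have hlog4 : 0 < Real.log 4 := Real.log_pos (by norm_num)
  -- the constant
  refine ⟨c₁ / (Real.exp 1 * (C * Real.log 4 + 1)), by positivity, fun Q Λ₀ Λ₁ Λ₂ F h ↦ ?_⟩
  have hQ := h.one_le_Q
  set ℒ₀ : ℝ := Real.log Q + Real.log 4 with hℒ₀
  have hℒ₀1 : 1 ≤ ℒ₀ := by
    have := TwistedZFR.one_le_ell hQ 0
    rwa [abs_zero, zero_add] at this
  have hℒ₀0 : 0 < ℒ₀ := by linarith
  -- no exceptional zeros: the hypothesis of `hbd` is vacuous
  have hexc : ∀ s : ℂ, ∀ a : ℂ, F a = 0 → a.im = 0 →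
      1 - 2 * c / (Real.log Q + Real.log 4) < a.re → (1 : ℝ) ≤ ‖s - a‖ := by
    intro s a ha him hre
    have him4 : Real.log (|a.im| + 4) = Real.log 4 := by rw [him, abs_zero, zero_add]
    have := (hzf false Q Λ₀ Λ₁ Λ₂ F h a ha (by rwa [him4])).1
    exact absurd this (by decide)
  -- the bound `‖F'/F(σ)‖ ≤ B` and `F σ ≠ 0` for real `σ ≥ 1`
  set B : ℝ := C * ℒ₀ ^ 3 * Real.log 4 with hB
  have hB0 : 0 ≤ B := by positivity
  have hreal : ∀ σ : ℝ, 1 ≤ σ → F σ ≠ 0 ∧ ‖deriv F σ / F σ‖ ≤ B := by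
    intro σ hσ
    have h1 : 1 - c / (Real.log Q + Real.log (|(σ : ℂ).im| + 4)) ≤ (σ : ℂ).re := by
      simp only [ofReal_im, abs_zero, zero_add, ofReal_re]
      have : 0 ≤ c / (Real.log Q + Real.log 4) := div_nonneg hc.le hℒ₀0.le
      linarith
    obtain ⟨hne, hle⟩ := hbd false Q Λ₀ Λ₁ Λ₂ F h (σ : ℂ) 1 one_pos le_rfl h1 (hexc (σ : ℂ))
    refine ⟨hne, hle.trans ?_⟩
    simp only [ofReal_im, abs_zero, zero_add, div_one]
    rw [hB]
  -- `δ = 1 / max B 1`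
  set B' : ℝ := max B 1 with hB'
  have hB'1 : 1 ≤ B' := le_max_right _ _
  have hB'0 : 0 < B' := by linarith
  have hBB' : B ≤ B' := le_max_left _ _
  set δ : ℝ := 1 / B' with hδ
  have hδ0 : 0 < δ := by positivity
  have hδ1 : δ ≤ 1 := by rw [hδ, div_le_one hB'0]; exact hB'1
  -- Grönwall on `[1, 1 + δ]` for `t ↦ F t`
  have hdiff : ∀ t : ℝ, 1 ≤ t → HasDerivAt (fun y : ℝ ↦ F y) (deriv F t) t := by
    intro t ht
    have hmem : (t : ℂ) ∈ {s : ℂ | 1 - η < s.re} := by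
      simp only [mem_setOf_eq, ofReal_re]; linarith
    have hopen : IsOpen {s : ℂ | 1 - η < s.re} := isOpen_lt continuous_const Complex.continuous_re
    exact ((h.differentiableOn _ hmem).differentiableAt (hopen.mem_nhds hmem)).hasDerivAt.comp_ofReal
  have hcont : ContinuousOn (fun y : ℝ ↦ F y) (Icc 1 (1 + δ)) := fun t ht ↦
    (hdiff t ht.1).continuousAt.continuousWithinAt
  have hgron := norm_le_gronwallBound_of_norm_deriv_right_le (f := fun y : ℝ ↦ F y)
    (f' := fun t ↦ deriv F t) (δ := ‖F 1‖) (K := B) (ε := 0) (a := 1) (b := 1 + δ) hcont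
    (fun t ht ↦ (hdiff t ht.1).hasDerivWithinAt) (by simp) (fun t ht ↦ by
      obtain ⟨hne, hle⟩ := hreal t ht.1
      rw [add_zero]
      have hFt : 0 < ‖F t‖ := norm_pos_iff.mpr hne
      rw [norm_div, div_le_iff₀ hFt] at hle
      exact hle)
    (1 + δ) ⟨by linarith, le_rfl⟩
  rw [gronwallBound_ε0, show (1 : ℝ) + δ - 1 = δ by ring] at hgron
  -- `exp (B δ) ≤ e`
  have hexp : Real.exp (B * δ) ≤ Real.exp 1 := by
    refine Real.exp_le_exp.mpr ?_
    rw [hδ, mul_one_div, div_le_one hB'0]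
    exact hBB'
  -- the lower field at `1 + δ`
  have hlow : c₁ * δ ≤ ‖F ((1 + δ : ℝ) : ℂ)‖ := by
    have := h.lower ((1 + δ : ℝ) : ℂ) (by simp; linarith) (by simp; linarith)
    simpa using this
  have hF1 : 0 ≤ ‖F 1‖ := norm_nonneg _
  -- assemble: `c₁ δ ≤ ‖F 1‖ e`, `δ = 1/B' ≥ 1/((C log 4 + 1) ℒ₀³)`
  have hkey : c₁ * δ ≤ ‖F 1‖ * Real.exp 1 := by
    have h1 : ‖F ((1 + δ : ℝ) : ℂ)‖ ≤ ‖F 1‖ * Real.exp (B * δ) := by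
      have := hgron; push_cast at this ⊢; simpa using this
    calc c₁ * δ ≤ ‖F ((1 + δ : ℝ) : ℂ)‖ := hlow
      _ ≤ ‖F 1‖ * Real.exp (B * δ) := h1
      _ ≤ ‖F 1‖ * Real.exp 1 := by gcongr
  have hB'le : B' ≤ (C * Real.log 4 + 1) * ℒ₀ ^ 3 := by
    have hℒ3 : 1 ≤ ℒ₀ ^ 3 := one_le_pow₀ hℒ₀1
    refine max_le ?_ ?_
    · rw [hB]; nlinarith [mul_nonneg hC hlog4.le]
    · nlinarith [mul_nonneg hC hlog4.le]
  have he : 0 < Real.exp 1 := Real.exp_pos 1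
  have hden : 0 < Real.exp 1 * (C * Real.log 4 + 1) := by positivity
  rw [div_le_iff₀ (by positivity : (0 : ℝ) < ℒ₀ ^ 3)]
  -- `c₁ / (e (C log4 + 1)) ≤ ‖F 1‖ ℒ₀³`
  rw [div_le_iff₀ hden]
  have : c₁ * δ * ((C * Real.log 4 + 1) * ℒ₀ ^ 3) ≥ c₁ := by
    have hδB : δ * ((C * Real.log 4 + 1) * ℒ₀ ^ 3) ≥ 1 := by
      rw [hδ, one_div, ge_iff_le, ← div_le_iff₀' (inv_pos.mpr hB'0), div_inv_eq_mul, one_mul]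
      exact hB'le
    nlinarith
  nlinarith [mul_le_mul_of_nonneg_right hkey (by positivity : (0 : ℝ) ≤ (C * Real.log 4 + 1) * ℒ₀ ^ 3)]

end TwistedZFRData

namespace GaussianCosetTheta


open Literature.NumberTheory.Sieve.FriedlanderIwaniecPrimes (GaussQuot)

/-- **`|L(1, ψ)| ≫ (log(M(k+2)) + log 4)⁻³` for the Hecke `L`-functions of `ℚ(i)` with a non-trivial
Grössencharakter**: there is an ABSOLUTE `c₀ > 0` such that for every modulus `M` with `4 ∣ M`, every
character `χ` of `(ℤ[i]/M)ˣ` and every `k ≥ 1`, `L(s, ψ) = heckeL M χ k` (`ψ = χ · (z/|z|)^k`) satisfies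
`c₀ / (log(M(k+2)) + log 4)³ ≤ |L(1, ψ)|` (there is no exceptional zero because `ψ² ≠ 1`;
Friedlander–Iwaniec (16.20) with Montgomery–Vaughan (11.7)). From `twistedZFRData_heckeL` and
`TwistedZFRData.exists_const_norm_one_ge`. [cite: FriedlanderIwaniecAnnals1998, §16 (16.20)]
[cite: MontgomeryVaughan2007, §11.1 Theorem 11.4 (11.7)] -/
theorem exists_norm_heckeL_one_ge :
    ∃ c₀ : ℝ, 0 < c₀ ∧ ∀ (M : ℕ) [NeZero M], 4 ∣ M → ∀ (χ : MulChar (GaussQuot M) ℂ) (k : ℕ), k ≠ 0 →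
      c₀ / (Real.log ((M : ℝ) * (k + 2)) + Real.log 4) ^ 3 ≤ ‖heckeL M χ k 1‖ := by
  obtain ⟨c₀, hc₀, h⟩ := TwistedZFRData.exists_const_norm_one_ge (η := 1) (A := 3) (Cg := nS)
    (c₁ := ((4 : ℝ) ^ 6 * nS)⁻¹) (K₀ := K0) (C₂ := C2) one_pos le_rfl (by norm_num)
    (by have := nS_pos; positivity) K0_nonneg C2_nonneg
  exact ⟨c₀, hc₀, fun M _ h4 χ k hk ↦ h _ _ _ _ _ (twistedZFRData_heckeL h4 χ hk)⟩

end GaussianCosetTheta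

end Literature.NumberTheory.LFunctions

end
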